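import Summits.NavierStokesRegularity.NavierStokesRegularity.Theorems.LerayQuarterDissipationFiniteDissipationLiouvilleHullCategoryTools
import HarnessLib

/-!
# Crux `FiniteDissipationLiouville` (stmt-NavierStokesRegularity-22144), line `birth`:
# CATEGORY ON THE SCALING HULL — the hull of a wandering recurrent member is not covered by
# countably many scaling orbits

Helper file (theorems only, `--supports` the crux), second of three. Let `𝒟_{C,K}` be the
finite-dissipation stratum of the route (Type-I ancient mild fields in the KNSS gauge,
`IsTypeIAncientMild C w`, with the quarter-rate dissipation law `∫‖∇w(s)‖² ≤ K/√(−s)`), acted on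
by the scaling flow `σ ↦ w_{e^σ}` (`nsRescale`). By the tree (`…CriticalRecurrent`, `…Lyapunov`)
the crux is the emptiness of the classes of SINGULAR, UNIFORMLY RECURRENT members ("critical
elements"); by `…Structure`/`…Hardness`/`…ClosingReduction` its residue beyond the catalogued open
problem `∀ c > 1, TypeIDSSLiouville c` (Bradshaw–Tsai 2017 OP 5.1, NECESSARY for the crux) is the
WANDERING stratum: critical elements that are not discretely self-similar on the past. This file
adds a clause of a new kind to the portrait — by CATEGORY (Baire) instead of compactness:

* `exists_orbitLimit_off_orbits` — a uniformly recurrent member `u ∈ 𝒟_{C,K}` (the item's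
  recurrence clause) which is NOT past-DSS has, for EVERY sequence `V : ℕ → fields` continuous on
  the open past, a scaling limit `W ∈ 𝒟_{C,K}` (uniform on the slab pieces and pointwise, along
  rescalings `u_{l_k}`, `l_k > 0`) that agrees on the past with NO rescaling of ANY `V i`: the
  scaling hull of a wandering critical element is not covered by countably many scaling orbits —
  "the wandering stratum, if non-empty, is uncountable modulo scaling". (Corollaries — no isolated
  counterexample, the DSS/wandering dichotomy, the wall version — in `…HullCategoryPortrait`.)

Model (as in `…RecurrentReductionDRecurrentUnif`, seat ns-lqd-p1): restrictions to the slab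
pieces `[−(n+2), −1/(n+2)] × B̄(0, n+2)`, i.e. the Hausdorff space `Π n, C(piece n, ℝ³)`;
compactness of the orbit closure from `RecurrentReductionD.orbitLimit` (KNSS compactness + Fatou);
the window recurrence clause gives late returns at every orbit point; Baire's theorem is the
abstract core `HullCategory.exists_lt_apply_eq_of_countable_cover`. No summit is proved by this
file; Navier–Stokes regularity is NOT proved by anything here; the crux stays FRONTIER (blocked on
`∀ c>1, TypeIDSSLiouville c`).

References: H. Furstenberg, *Recurrence in Ergodic Theory and Combinatorial Number Theory* (1981),
Ch. 1 §4 (uniform recurrence, minimal sets) [Furstenberg1981]; G. Koch, N. Nadirashvili,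
G. Seregin, V. Šverák, Acta Math. 203 (2009) = arXiv:0709.3599, §4 (compactness of the Type-I
class) [KochNadirashviliSereginSverak2009]; Z. Bradshaw, T.-P. Tsai, Comm. PDE 42 (2017), §5
OP 5.1 [BradshawTsai2017CPDE]. Baire's category theorem: Mathlib (`BaireSpace`).
-/

noncomputable section

-- the summit and its single problem share the name (D-0017 nested layout)
set_option linter.dupNamespace false

namespace Summit.NavierStokesRegularity.NavierStokesRegularity.Theorems.FiniteDissipationLiouville.HullCategory

open scoped Topology
open MeasureTheory Set Function Filter Metric TopologicalSpace Topology
open Literature.Analysis.FluidPDE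
open Literature.Dynamics.TopologicalDynamics
open Summit.NavierStokesRegularity.NavierStokesRegularity.Theorems.RecurrentReductionD

/-! ### §3 The main theorem: the scaling hull of a wandering recurrent member is not covered by
countably many scaling orbits -/

/-- **MAIN (category on the scaling hull).** Let `u ∈ 𝒟_{C,K}` be UNIFORMLY RECURRENT under the
scaling flow (the item's clause: relatively dense `ε`-return times on every window
`[−R², −R⁻²] × B̄(0,R)`) and NOT discretely self-similar on the past with any factor `c > 1`. Then
for EVERY sequence `V : ℕ → fields` continuous on the open past there are scales `l_k > 0` and a
scaling limit `W ∈ 𝒟_{C,K}` of `u` (uniform on the slab pieces and pointwise on the open past)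
which agrees on the past with NO rescaling `(V i)_c`, `c > 0`, of any `V i`. Proof: in the model
`Π n, C(piece n, ℝ³)` the orbit closure of `u` is compact (`RecurrentReductionD.orbitLimit`) and
Hausdorff, `u`'s curve returns late to each of its points (window recurrence, dilated pieces),
and the curves of the `V i` cohere with it under the flow; if every orbit limit lay on one of
their orbits, `exists_lt_apply_eq_of_countable_cover` (Baire) would make `u` past-DSS.
[cite: Furstenberg1981, Ch. 1 §4 (minimal sets; recurrence)] [cite: KochNadirashviliSereginSverak2009, Prop. 4.1 and Lemma 6.1 (arXiv:0709.3599 pp. 8, 11)] -/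
theorem exists_orbitLimit_off_orbits {C K : ℝ}
    {u : ℝ → EuclideanSpace ℝ (Fin 3) → EuclideanSpace ℝ (Fin 3)}
    (hu : IsTypeIAncientMild C u)
    (hlaw : ∀ s : ℝ, s < 0 → ∫⁻ x, ‖fderiv ℝ (u s) x‖ₑ ^ 2 ≤ ENNReal.ofReal (K / Real.sqrt (-s)))
    (hrec : ∀ ε > 0, ∀ R > 1, ∃ L > 0, ∀ a : ℝ, ∃ σ ∈ Icc a (a + L),
      ∀ s ∈ Icc (-(R ^ 2)) (-(R⁻¹) ^ 2), ∀ y ∈ closedBall (0 : EuclideanSpace ℝ (Fin 3)) R,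
        ‖Real.exp σ • u (Real.exp (2 * σ) * s) (Real.exp σ • y) - u s y‖ ≤ ε)
    (hndss : ∀ c : ℝ, 1 < c → ¬ ∀ t : ℝ, t < 0 → ∀ x, c • u (c ^ 2 * t) (c • x) = u t x)
    (V : ℕ → ℝ → EuclideanSpace ℝ (Fin 3) → EuclideanSpace ℝ (Fin 3))
    (hV : ∀ i, ContinuousOn (uncurry (V i)) (Iio 0 ×ˢ univ)) :
    ∃ l : ℕ → ℝ, (∀ k, 0 < l k) ∧
      ∃ W : ℝ → EuclideanSpace ℝ (Fin 3) → EuclideanSpace ℝ (Fin 3),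
        IsTypeIAncientMild C W ∧
        (∀ s : ℝ, s < 0 → ∫⁻ x, ‖fderiv ℝ (W s) x‖ₑ ^ 2 ≤ ENNReal.ofReal (K / Real.sqrt (-s))) ∧
        (∀ n : ℕ, TendstoUniformlyOn (fun k z => nsRescale (l k) u z.1 z.2) (fun z => W z.1 z.2)
          atTop (Icc (-((n : ℝ) + 2)) (-(1 / ((n : ℝ) + 2))) ×ˢ
            closedBall (0 : EuclideanSpace ℝ (Fin 3)) ((n : ℝ) + 2))) ∧
        (∀ t < 0, ∀ x, Tendsto (fun k => nsRescale (l k) u t x) atTop (𝓝 (W t x))) ∧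
        ∀ i : ℕ, ∀ c : ℝ, 0 < c → ∃ t : ℝ, t < 0 ∧ ∃ x, W t x ≠ nsRescale c (V i) t x := by
  classical
  by_contra H
  push Not at H
  -- dilated slab pieces lie in larger slab pieces (as in `…RecurrentReductionDRecurrentUnif`)
  have hdil : ∀ {l : ℝ}, 0 < l → ∀ n : ℕ, ∃ m : ℕ, ∀ z ∈ Icc (-((n : ℝ) + 2)) (-(1 / ((n : ℝ) + 2))) ×ˢ
        closedBall (0 : EuclideanSpace ℝ (Fin 3)) ((n : ℝ) + 2),
      ((l ^ 2 * z.1, l • z.2) : ℝ × EuclideanSpace ℝ (Fin 3)) ∈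
        Icc (-((m : ℝ) + 2)) (-(1 / ((m : ℝ) + 2))) ×ˢ
          closedBall (0 : EuclideanSpace ℝ (Fin 3)) ((m : ℝ) + 2) := by
    intro l hl n
    set N : ℝ := (n : ℝ) + 2 with hN
    have hN0 : 0 < N := by positivity
    have hl2 : 0 < l ^ 2 := by positivity
    have hli : 0 < (l ^ 2)⁻¹ := inv_pos.2 hl2
    obtain ⟨m, hm⟩ := exists_nat_ge ((l ^ 2 + (l ^ 2)⁻¹ + l) * N)
    have hM0 : (0 : ℝ) < (m : ℝ) + 2 := by positivity
    have hM : (l ^ 2 + (l ^ 2)⁻¹ + l) * N ≤ (m : ℝ) + 2 := hm.trans (by linarith)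
    have hA : l ^ 2 * N ≤ (m : ℝ) + 2 := le_trans (by nlinarith) hM
    have hB : (l ^ 2)⁻¹ * N ≤ (m : ℝ) + 2 := le_trans (by nlinarith) hM
    have hC : l * N ≤ (m : ℝ) + 2 := le_trans (by nlinarith) hM
    refine ⟨m, fun z hz => ?_⟩
    obtain ⟨⟨h1, h2⟩, h3⟩ := mem_slabPiece.1 hz
    refine mem_slabPiece.2 ⟨⟨by nlinarith, ?_⟩, ?_⟩
    · have key : 1 / ((m : ℝ) + 2) ≤ l ^ 2 * (1 / N) := by
        rw [div_le_iff₀ hM0]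
        calc (1 : ℝ) = l ^ 2 * (1 / N) * ((l ^ 2)⁻¹ * N) := by field_simp
          _ ≤ l ^ 2 * (1 / N) * ((m : ℝ) + 2) := mul_le_mul_of_nonneg_left hB (by positivity)
      have : l ^ 2 * z.1 ≤ l ^ 2 * (-(1 / N)) := mul_le_mul_of_nonneg_left h2 hl2.le
      show l ^ 2 * z.1 ≤ -(1 / ((m : ℝ) + 2))
      linarith
    · show ‖l • z.2‖ ≤ (m : ℝ) + 2
      rw [norm_smul, Real.norm_of_nonneg hl.le]
      nlinarith
  -- ## the slab pieces and the model space
  set T : ℕ → Set (ℝ × EuclideanSpace ℝ (Fin 3)) := fun n =>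
    Icc (-((n : ℝ) + 2)) (-(1 / ((n : ℝ) + 2))) ×ˢ
      closedBall (0 : EuclideanSpace ℝ (Fin 3)) ((n : ℝ) + 2) with hT
  haveI hTc : ∀ n, CompactSpace (T n) := fun n =>
    isCompact_iff_compactSpace.1 (isCompact_slabPiece n)
  have hTsub : ∀ n, T n ⊆ Iio (0:ℝ) ×ˢ (univ : Set (EuclideanSpace ℝ (Fin 3))) := fun n z hz =>
    ⟨neg_of_mem_slabPiece hz, mem_univ _⟩
  have hres : ∀ (p : ℝ → EuclideanSpace ℝ (Fin 3) → EuclideanSpace ℝ (Fin 3)),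
      ContinuousOn (uncurry p) (Iio 0 ×ˢ univ) → ∀ n : ℕ, Continuous fun z : T n => p z.1.1 z.1.2 :=
    fun p hp n => continuousOn_iff_continuous_restrict.1 (hp.mono (hTsub n))
  -- restriction of a field (continuous on the open past) to the pieces
  let Φ : (p : ℝ → EuclideanSpace ℝ (Fin 3) → EuclideanSpace ℝ (Fin 3)) →
      ContinuousOn (uncurry p) (Iio 0 ×ˢ univ) → ((n : ℕ) → C(T n, EuclideanSpace ℝ (Fin 3))) :=
    fun p hp n => ⟨fun z => p z.1.1 z.1.2, hres p hp n⟩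
  have hΦext : ∀ p hp q hq, (∀ t : ℝ, t < 0 → ∀ x, p t x = q t x) → Φ p hp = Φ q hq := by
    intro p hp q hq hpq
    funext n
    refine ContinuousMap.ext fun z => ?_
    exact hpq z.1.1 (neg_of_mem_slabPiece z.2) z.1.2
  have hpast_of_eq : ∀ p hp q hq, Φ p hp = Φ q hq → ∀ t : ℝ, t < 0 → ∀ x, p t x = q t x := by
    intro p hp q hq heq t ht x
    obtain ⟨n, hn⟩ := exists_mem_slabPiece (E := EuclideanSpace ℝ (Fin 3)) ht x
    have h1 := DFunLike.congr_fun (congrFun heq n) ⟨(t, x), hn⟩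
    exact h1
  have huc : ContinuousOn (uncurry u) (Iio (0 : ℝ) ×ˢ (univ : Set (EuclideanSpace ℝ (Fin 3)))) :=
    hu.continuousOn_uncurry
  -- the curve of a field continuous on the open past: `σ ↦ Φ (p_{e^σ})`
  let crv : (p : ℝ → EuclideanSpace ℝ (Fin 3) → EuclideanSpace ℝ (Fin 3)) →
      ContinuousOn (uncurry p) (Iio (0 : ℝ) ×ˢ (univ : Set (EuclideanSpace ℝ (Fin 3)))) → ℝ →
        ((n : ℕ) → C(T n, EuclideanSpace ℝ (Fin 3))) :=
    fun p hp σ => Φ (nsRescale (Real.exp σ) p) (continuousOn_uncurry_nsRescale hp (Real.exp_pos σ))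
  -- ## the curves are continuous (joint continuity on `ℝ × piece`, currying)
  have hcrv : ∀ p hp, Continuous (crv p hp) := by
    intro p hp
    refine continuous_pi fun n => ?_
    have h1 : Continuous fun q : ℝ × T n => Real.exp q.1 := Real.continuous_exp.comp continuous_fst
    have h2 : Continuous fun q : ℝ × T n => ((q.2 : ℝ × EuclideanSpace ℝ (Fin 3))) :=
      continuous_subtype_val.comp continuous_snd
    have hd : Continuous fun q : ℝ × T n =>
        ((Real.exp q.1) ^ 2 * (q.2 : ℝ × EuclideanSpace ℝ (Fin 3)).1,
          Real.exp q.1 • (q.2 : ℝ × EuclideanSpace ℝ (Fin 3)).2) :=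
      ((h1.pow 2).mul (continuous_fst.comp h2)).prodMk (h1.smul (continuous_snd.comp h2))
    have hmaps : ∀ q : ℝ × T n,
        (((Real.exp q.1) ^ 2 * (q.2 : ℝ × EuclideanSpace ℝ (Fin 3)).1,
          Real.exp q.1 • (q.2 : ℝ × EuclideanSpace ℝ (Fin 3)).2) : ℝ × EuclideanSpace ℝ (Fin 3)) ∈
          Iio (0 : ℝ) ×ˢ (univ : Set (EuclideanSpace ℝ (Fin 3))) := fun q =>
      ⟨mul_neg_of_pos_of_neg (pow_pos (Real.exp_pos q.1) 2) (neg_of_mem_slabPiece q.2.2),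
        mem_univ _⟩
    have h3 := hp.comp_continuous hd hmaps
    have hj : Continuous fun q : ℝ × T n => nsRescale (Real.exp q.1) p q.2.1.1 q.2.1.2 :=
      h1.smul h3
    let F : C(ℝ × T n, EuclideanSpace ℝ (Fin 3)) := ⟨_, hj⟩
    have hF : (fun σ => crv p hp σ n) = fun σ => F.curry σ := by
      funext σ
      exact ContinuousMap.ext fun z => rfl
    rw [hF]
    exact F.curry.continuous
  -- ## convergence in the model = uniform convergence on every piece
  have htend : ∀ (Fj : ℕ → ℝ → EuclideanSpace ℝ (Fin 3) → EuclideanSpace ℝ (Fin 3))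
      (hFj : ∀ j, ContinuousOn (uncurry (Fj j)) (Iio (0 : ℝ) ×ˢ (univ : Set (EuclideanSpace ℝ (Fin 3)))))
      (G : ℝ → EuclideanSpace ℝ (Fin 3) → EuclideanSpace ℝ (Fin 3))
      (hG : ContinuousOn (uncurry G) (Iio (0 : ℝ) ×ˢ (univ : Set (EuclideanSpace ℝ (Fin 3))))),
      Tendsto (fun j => Φ (Fj j) (hFj j)) atTop (𝓝 (Φ G hG)) ↔
        ∀ n, TendstoUniformlyOn (fun j z => Fj j z.1 z.2) (fun z => G z.1 z.2) atTop (T n) := by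
    intro Fj hFj G hG
    rw [tendsto_pi_nhds]
    constructor
    · intro h n
      have h1 := h n
      rw [ContinuousMap.tendsto_iff_tendstoUniformly] at h1
      rw [tendstoUniformlyOn_iff_tendstoUniformly_comp_coe]
      exact h1
    · intro h n
      rw [ContinuousMap.tendsto_iff_tendstoUniformly]
      have h1 := h n
      rw [tendstoUniformlyOn_iff_tendstoUniformly_comp_coe] at h1
      exact h1
  -- ## the curve of `u`, the curves of the `V i`
  let γ : ℝ → ((n : ℕ) → C(T n, EuclideanSpace ℝ (Fin 3))) := crv u huc
  let δ : ℕ → ℝ → ((n : ℕ) → C(T n, EuclideanSpace ℝ (Fin 3))) := fun i => crv (V i) (hV i)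
  -- ## KEY: subsequential limits of orbit sequences (KNSS compactness, `orbitLimit`)
  have hkey : ∀ σs : ℕ → ℝ, ∃ (W : ℝ → EuclideanSpace ℝ (Fin 3) → EuclideanSpace ℝ (Fin 3))
      (hW : IsTypeIAncientMild C W) (ψ : ℕ → ℕ), StrictMono ψ ∧
      (∀ s : ℝ, s < 0 → ∫⁻ x, ‖fderiv ℝ (W s) x‖ₑ ^ 2 ≤ ENNReal.ofReal (K / Real.sqrt (-s))) ∧
      (∀ n : ℕ, TendstoUniformlyOn (fun j z => nsRescale (Real.exp (σs (ψ j))) u z.1 z.2)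
        (fun z => W z.1 z.2) atTop (T n)) ∧
      (∀ t < 0, ∀ x, Tendsto (fun j => nsRescale (Real.exp (σs (ψ j))) u t x) atTop (𝓝 (W t x))) ∧
      Tendsto (fun j => γ (σs (ψ j))) atTop (𝓝 (Φ W hW.continuousOn_uncurry)) := by
    intro σs
    obtain ⟨ψ, hψ, W, hW, hlawW, hWu, hpt⟩ :=
      orbitLimit hu hlaw (fun k => Real.exp (σs k)) (fun k => Real.exp_pos _)
    refine ⟨W, hW, ψ, hψ, hlawW, hWu, hpt, ?_⟩
    exact (htend (fun j => nsRescale (Real.exp (σs (ψ j))) u)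
      (fun j => continuousOn_uncurry_nsRescale huc (Real.exp_pos _)) W hW.continuousOn_uncurry).2 hWu
  -- ## compactness of the orbit closure (sequential compactness in the metrisable model)
  have hKc : IsCompact (closure (range γ)) := by
    letI mY : PseudoMetricSpace ((n : ℕ) → C(T n, EuclideanSpace ℝ (Fin 3))) :=
      pseudoMetrizableSpacePseudoMetric _
    refine IsSeqCompact.isCompact fun x hx => ?_
    have hnear : ∀ k : ℕ, ∃ σ : ℝ, dist (x k) (γ σ) < 1 / ((k : ℝ) + 1) := by
      intro k
      have hk : (0 : ℝ) < 1 / ((k : ℝ) + 1) := by positivity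
      obtain ⟨b, hb, hd⟩ := Metric.mem_closure_iff.1 (hx k) (1 / ((k : ℝ) + 1)) hk
      obtain ⟨σ, rfl⟩ := hb
      exact ⟨σ, hd⟩
    choose σs hσs using hnear
    obtain ⟨W, hW, ψ, hψ, -, -, -, hlim⟩ := hkey σs
    refine ⟨Φ W hW.continuousOn_uncurry, ?_, ψ, hψ, ?_⟩
    · exact isClosed_closure.mem_of_tendsto hlim
        (Eventually.of_forall fun j => subset_closure ⟨_, rfl⟩)
    · refine hlim.congr_dist ?_
      have h1 : Tendsto (fun j => 1 / (((ψ j : ℕ) : ℝ) + 1)) atTop (𝓝 0) :=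
        (tendsto_one_div_add_atTop_nhds_zero_nat (𝕜 := ℝ)).comp hψ.tendsto_atTop
      refine squeeze_zero (fun j => dist_nonneg) (fun j => ?_) h1
      rw [dist_comm]
      exact (hσs (ψ j)).le
  -- ## every point of the orbit closure lies on the orbit of some `V i` (by `H`)
  have hcover : closure (range γ) ⊆ ⋃ i, range (δ i) := by
    letI mY : PseudoMetricSpace ((n : ℕ) → C(T n, EuclideanSpace ℝ (Fin 3))) :=
      pseudoMetrizableSpacePseudoMetric _
    intro k hk
    obtain ⟨xs, hxs, hxk⟩ := mem_closure_iff_seq_limit.1 hk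
    choose σs hσs using hxs
    obtain ⟨W, hW, ψ, hψ, hlawW, hWu, hpt, hlim⟩ := hkey σs
    have hxk' : Tendsto (fun j => γ (σs (ψ j))) atTop (𝓝 k) :=
      (hxk.comp hψ.tendsto_atTop).congr fun j => (hσs (ψ j)).symm
    have hkW : k = Φ W hW.continuousOn_uncurry := tendsto_nhds_unique hxk' hlim
    obtain ⟨i, c, hc, hWc⟩ :=
      H (fun j => Real.exp (σs (ψ j))) (fun j => Real.exp_pos _) W hW hlawW hWu hpt
    refine mem_iUnion.2 ⟨i, Real.log c, ?_⟩
    rw [hkW]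
    refine hΦext (nsRescale (Real.exp (Real.log c)) (V i))
      (continuousOn_uncurry_nsRescale (hV i) (Real.exp_pos _)) W hW.continuousOn_uncurry
      fun t ht x => ?_
    rw [Real.exp_log hc]
    exact (hWc t ht x).symm
  -- ## coherence of the curves under time translation (one flow)
  have hcoh : ∀ i s σ, γ s = δ i σ → ∀ τ : ℝ, γ (s + τ) = δ i (σ + τ) := by
    intro i s σ heq τ
    have hsσ := hpast_of_eq (nsRescale (Real.exp s) u)
      (continuousOn_uncurry_nsRescale huc (Real.exp_pos s)) (nsRescale (Real.exp σ) (V i))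
      (continuousOn_uncurry_nsRescale (hV i) (Real.exp_pos σ)) heq
    refine hΦext (nsRescale (Real.exp (s + τ)) u)
      (continuousOn_uncurry_nsRescale huc (Real.exp_pos _)) (nsRescale (Real.exp (σ + τ)) (V i))
      (continuousOn_uncurry_nsRescale (hV i) (Real.exp_pos _)) fun t ht x => ?_
    have ht' : Real.exp τ ^ 2 * t < 0 := mul_neg_of_pos_of_neg (by positivity) ht
    rw [Real.exp_add, Real.exp_add, nsRescale_mul, nsRescale_mul, nsRescale_apply (Real.exp τ),
      nsRescale_apply (Real.exp τ), hsσ _ ht' _]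
  -- ## late returns of the curve of `u` to each of its points (window recurrence)
  have hrecY : ∀ s : ℝ, ∃ s' : ℕ → ℝ, Tendsto s' atTop atTop ∧
      Tendsto (fun j => γ (s' j)) atTop (𝓝 (γ s)) := by
    intro s
    have hes : 0 < Real.exp s := Real.exp_pos s
    have hret : ∀ j : ℕ, ∃ σ : ℝ, (j : ℝ) + 1 ≤ σ ∧
        ∀ s₁ ∈ Icc (-(((j : ℝ) + 2) ^ 2)) (-((((j : ℝ) + 2))⁻¹) ^ 2),
          ∀ y ∈ closedBall (0 : EuclideanSpace ℝ (Fin 3)) ((j : ℝ) + 2),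
            ‖Real.exp σ • u (Real.exp (2 * σ) * s₁) (Real.exp σ • y) - u s₁ y‖ ≤
              (Real.exp s)⁻¹ / ((j : ℝ) + 1) := by
      intro j
      obtain ⟨L, -, hwin⟩ := hrec ((Real.exp s)⁻¹ / ((j : ℝ) + 1)) (by positivity) ((j : ℝ) + 2)
        (by linarith [j.cast_nonneg (α := ℝ)])
      obtain ⟨σ, hσ, hσw⟩ := hwin ((j : ℝ) + 1)
      exact ⟨σ, hσ.1, hσw⟩
    choose σs hσs₁ hσs₂ using hret
    refine ⟨fun j => s + σs j, ?_, ?_⟩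
    · have h0 : Tendsto (fun j : ℕ => s + ((j : ℝ) + 1)) atTop atTop :=
        tendsto_atTop_add_const_left atTop s
          (tendsto_atTop_add_const_right atTop (1 : ℝ) tendsto_natCast_atTop_atTop)
      exact tendsto_atTop_mono (fun j => by linarith [hσs₁ j]) h0
    · refine (htend (fun j => nsRescale (Real.exp (s + σs j)) u)
        (fun j => continuousOn_uncurry_nsRescale huc (Real.exp_pos _)) (nsRescale (Real.exp s) u)
        (continuousOn_uncurry_nsRescale huc hes)).2 fun n => ?_
      obtain ⟨m, hm⟩ := hdil hes n
      rw [Metric.tendstoUniformlyOn_iff]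
      intro ε hε
      have hev₁ : ∀ᶠ j : ℕ in atTop, m ≤ j := eventually_ge_atTop m
      have hev₂ : ∀ᶠ j : ℕ in atTop, 1 / ((j : ℝ) + 1) < ε :=
        (tendsto_one_div_add_atTop_nhds_zero_nat (𝕜 := ℝ)).eventually (gt_mem_nhds hε)
      filter_upwards [hev₁, hev₂] with j hj₁ hj₂ z hz
      have hzm := hm z hz
      obtain ⟨⟨h1, h2⟩, h3⟩ := mem_slabPiece.1 hzm
      have hjm : (m : ℝ) + 2 ≤ (j : ℝ) + 2 := by
        have : (m : ℝ) ≤ (j : ℝ) := by exact_mod_cast hj₁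
        linarith
      have hm0 : (0 : ℝ) < (m : ℝ) + 2 := by positivity
      have hwin₁ : Real.exp s ^ 2 * z.1 ∈ Icc (-(((j : ℝ) + 2) ^ 2)) (-((((j : ℝ) + 2))⁻¹) ^ 2) := by
        constructor
        · have : (j : ℝ) + 2 ≤ ((j : ℝ) + 2) ^ 2 := by nlinarith
          change -(((j : ℝ) + 2) ^ 2) ≤ Real.exp s ^ 2 * z.1
          linarith
        · have h4 : (((j : ℝ) + 2)⁻¹) ^ 2 ≤ 1 / ((m : ℝ) + 2) := by
            rw [inv_pow, one_div]
            exact inv_anti₀ hm0 (by nlinarith)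
          change Real.exp s ^ 2 * z.1 ≤ -((((j : ℝ) + 2))⁻¹) ^ 2
          linarith
      have hwin₂ : Real.exp s • z.2 ∈ closedBall (0 : EuclideanSpace ℝ (Fin 3)) ((j : ℝ) + 2) := by
        rw [mem_closedBall, dist_zero_right]
        exact h3.trans hjm
      have key := hσs₂ j (Real.exp s ^ 2 * z.1) hwin₁ (Real.exp s • z.2) hwin₂
      have e : Real.exp (s + σs j) = Real.exp (σs j) * Real.exp s := by
        rw [Real.exp_add, mul_comm]
      have e2 : Real.exp (σs j) ^ 2 = Real.exp (2 * σs j) := by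
        rw [← Real.exp_nat_mul]; norm_num
      have hF : nsRescale (Real.exp (s + σs j)) u z.1 z.2 =
          Real.exp s • (Real.exp (σs j) • u (Real.exp (2 * σs j) * (Real.exp s ^ 2 * z.1))
            (Real.exp (σs j) • (Real.exp s • z.2))) := by
        rw [e, nsRescale_mul, nsRescale_apply, nsRescale_apply, e2]
      have hG : nsRescale (Real.exp s) u z.1 z.2 =
          Real.exp s • u (Real.exp s ^ 2 * z.1) (Real.exp s • z.2) := rfl
      rw [hF, hG, dist_eq_norm, ← smul_sub, norm_smul, Real.norm_of_nonneg hes.le, norm_sub_rev]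
      calc Real.exp s * ‖Real.exp (σs j) • u (Real.exp (2 * σs j) * (Real.exp s ^ 2 * z.1))
              (Real.exp (σs j) • (Real.exp s • z.2)) - u (Real.exp s ^ 2 * z.1) (Real.exp s • z.2)‖
          ≤ Real.exp s * ((Real.exp s)⁻¹ / ((j : ℝ) + 1)) := mul_le_mul_of_nonneg_left key hes.le
        _ = 1 / ((j : ℝ) + 1) := by field_simp
        _ < ε := hj₂
  -- ## Baire: the curve of `u` is periodic, i.e. `u` is past-DSS — contradiction
  obtain ⟨a, b, hab, heq⟩ :=
    exists_lt_apply_eq_of_countable_cover hKc hrecY δ (fun i => hcrv (V i) (hV i)) hcover hcoh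
  have hpast := hpast_of_eq (nsRescale (Real.exp a) u)
    (continuousOn_uncurry_nsRescale huc (Real.exp_pos a)) (nsRescale (Real.exp b) u)
    (continuousOn_uncurry_nsRescale huc (Real.exp_pos b)) heq
  have hc1 : 1 < Real.exp (b - a) := by
    have h := Real.exp_lt_exp.2 (sub_pos.2 hab)
    rwa [Real.exp_zero] at h
  exact hndss (Real.exp (b - a)) hc1 (pastDss_of_rescalings_agree hpast)



end Summit.NavierStokesRegularity.NavierStokesRegularity.Theorems.FiniteDissipationLiouville.HullCategory

end
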